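import Literature.Probability.RandomPlanarGeometry.LoewnerInverseMeasurable
import Literature.Probability.RandomPlanarGeometry.LoewnerSwallowedInterval
import Literature.Probability.RandomPlanarGeometry.SLESwallowAtOnce
import Literature.Probability.RandomPlanarGeometry.SLETransienceZeroOneAt
import Literature.Probability.RandomPlanarGeometry.LoewnerAccessesAtHit
import Literature.Probability.RandomPlanarGeometry.LoewnerHullCocycle
import Literature.Probability.RandomPlanarGeometry.SLETraceShift
import Literature.Probability.RandomPlanarGeometry.SLETransienceSimple
import Literature.Probability.RandomPlanarGeometry.SLETraceContinuity
import Mathlib.Topology.MetricSpace.Sequences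
import HarnessLib

/-!
# Transience of the SLE trace for `4 < κ < 8` (Rohde–Schramm (2005), Lemma 7.3)

Trunk T-STOCH. We prove, from Rohde–Schramm's derivative estimate Cor. 3.5 (the named fact
`RohdeSchramm2005_cor35`, through which SLE_κ, `κ ≠ 8`, is a.s. generated by a curve), that for
`4 < κ < 8` the SLE_κ trace is a.s. transient:
`tendsto_norm_sleTrace_atTop_of_cor35_of_four_lt_of_lt_eight`. This is the case `κ ∈ (4, 8)` of
Rohde–Schramm (2005), Thm. 7.1, whose proof (Lemma 7.3, p. 910) we follow, with the Markov
property applied at a fixed rational time instead of the stopping time `τ(1)`: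

1. (deterministic, `Loewner.IsGeneratedByCurve.exists_accessGap_after_swallowingTime_one`) Let
   `τ = T_1` be the swallowing time of `1`. Shortly after `τ`, at every time `t = τ + d`, `d ≤ d₀`,
   all real zeros `v` of the boundary extension `f̄ₜ` of `gₜ⁻¹` ("accesses of `0` in `Hₜ`") satisfy
   `v ≤ Wₜ - η/2` (`LoewnerAccessesAtHit`: at `τ` they are `≤ W_τ - η`, and this persists), and
   they are bounded below; so the countable `accessGapTest` (`LoewnerInverseMeasurable`) holds at
   some rational time with some integers `a = -N < b = -1/(j+1) < 0`; a.s. `T_1 < ∞` (`κ > 4`), so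
   some such past event `A ∈ 𝓕_t` has positive probability (`exists_measure_accessGapTest_pos`).
2. (Markov property, `SLESwallowAtOnce`) Independently of `A`, with positive probability the chain
   of the increments `W(t + ·) - W(t)` swallows `a' = a - 1 < b' = b/2 < 0` at the same time
   `T ≤ s₀` (Rohde–Schramm's Lemma 6.6 in the weak form `measure_swallowingTime_eq_pos`, reflected).
3. (deterministic, `Loewner.IsGeneratedByCurve.exists_halfDisc_subset_hull_add`) On both events,
   `K_{t+s₀} ⊇ {z ∈ ℍ : |z| < ε}` for some `ε > 0`: if `zₙ → 0` in `H_{t+s₀} = fₜ(H^{(t)}_{s₀} + Wₜ)`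
   (hull cocycle, `LoewnerHullCocycle`), the points `g_t(zₙ) - Wₜ ∈ H^{(t)}_{s₀}` accumulate at a
   real zero of `f̄ₜ(· + Wₜ)`, i.e. in `[a, b] ⊂ (a', b')`, which is sealed off from `H^{(t)}_{s₀}`
   (`LoewnerSwallowedInterval`); contradiction.
4. A sealed half-disc with positive probability at a fixed time gives a.s. transience
   (`tendsto_norm_sleTrace_atTop_of_measure_halfDisc_ne_zero_at`: zero-one law and scaling,
   `SLETransienceZeroOneAt`).

## References

* S. Rohde, O. Schramm, *Basic properties of SLE*, Ann. of Math. 161 (2005), Thm. 7.1,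
  Lemma 7.3 (p. 910), Lemma 6.6, Prop. 2.1.
* G. F. Lawler, *Conformally Invariant Processes in the Plane*, AMS (2005), §6.2, Prop. 6.10.
-/

noncomputable section

open Set Filter Topology MeasureTheory Metric Complex
open UpperHalfPlane (upperHalfPlaneSet isOpen_upperHalfPlaneSet)
open scoped NNReal ENNReal

namespace Literature.Probability.RandomPlanarGeometry

namespace Loewner

variable {W : ℝ≥0 → ℝ} {γ : ℝ≥0 → ℂ}

/-! ### Step 1: the accesses of `0` shortly after `τ = T_1` -/

/-- **Shortly after `τ = T_1`, all accesses of `0` lie left of `Wₜ - η/2`.** Let the chain of the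
continuous `W`, `W 0 = 0`, be generated by `γ` and let `1` be swallowed at the finite time `τ`.
Then there are `η > 0` and `d₀ > 0` such that for every `d ≤ d₀` every real zero `v` of
`f̄_{τ+d}` satisfies `v ≤ W(τ + d) - η/2`. At `τ` itself: `p = γ(τ) ≥ 1` is swallowed exactly at `τ`
with all `x > p` alive (swallowing = hitting of real rays), so `IsGeneratedByCurve.exists_accesses_le`
gives `η`; persistence for small `d` is `IsGeneratedByCurve.accesses_le_of_near` (continuity of `W`
at `τ`). [cite: RohdeSchramm2005, proof of Lemma 7.3 (p. 910)] -/
theorem IsGeneratedByCurve.exists_accessGap_after_swallowingTime_one (hγ : IsGeneratedByCurve W γ)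
    (hW : Continuous W) (hW0 : W 0 = 0) {τ : ℝ≥0} (hτ : swallowingTime W (1 : ℝ) = τ) :
    ∃ η : ℝ, 0 < η ∧ ∃ d₀ : ℝ≥0, 0 < d₀ ∧ ∀ d : ℝ≥0, d ≤ d₀ →
      ∀ v : ℝ, bdryInv W (τ + d) v = 0 → v ≤ W (τ + d) - η / 2 := by
  -- the landing point `p = γ(τ) ≥ 1`
  have hray := hγ.apply_mem_realRay_of_swallowingTime_eq hW hW0 one_ne_zero hτ
  rw [mem_realRay_iff] at hray
  obtain ⟨hτim, hτre, -⟩ := hray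
  have hτre : 1 ≤ (γ τ).re := hτre one_pos
  set p : ℝ := (γ τ).re with hp
  have hp0 : 0 < p := one_pos.trans_le hτre
  have hγτ : γ τ = (p : ℂ) := Complex.ext (by simp [hp]) (by simp [hτim])
  -- `T_p = τ`
  have hτ1 : firstHit γ (realRay 1) = τ := by
    rwa [swallowingTime_ofReal_eq_firstHit_of_ne hW hW0 hγ one_ne_zero] at hτ
  have hτp : swallowingTime W p = τ := by
    rw [swallowingTime_ofReal_eq_firstHit_of_ne hW hW0 hγ hp0.ne']
    refine le_antisymm (firstHit_le ?_) ?_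
    · rw [hγτ]; exact ofReal_mem_realRay p
    · rw [← hτ1]
      exact firstHit_mono γ (realRay_subset_realRay_of_pos one_pos hτre)
  -- all `x > p` are alive at `τ`
  have halive : ∀ x : ℝ, p < x → (τ : WithTop ℝ≥0) < swallowingTime W x := by
    intro x hpx
    have hx0 : 0 < x := hp0.trans hpx
    rw [swallowingTime_ofReal_eq_firstHit_of_ne hW hW0 hγ hx0.ne']
    have hle : (τ : WithTop ℝ≥0) ≤ firstHit γ (realRay x) := by
      rw [← hτ1]
      exact firstHit_mono γ (realRay_subset_realRay_of_pos one_pos (hτre.trans hpx.le))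
    refine lt_of_le_of_ne hle fun heq ↦ ?_
    obtain ⟨t₀, ht₀, hmem⟩ := exists_firstHit_eq_coe hγ.continuous (isClosed_realRay x)
      (by rw [← heq]; exact WithTop.coe_ne_top)
    rw [← heq] at ht₀
    have ht₀τ : t₀ = τ := (WithTop.coe_eq_coe.1 ht₀).symm
    rw [ht₀τ, mem_realRay_iff] at hmem
    have := hmem.2.1 hx0
    rw [← hp] at this
    linarith
  have htip : bdryInv W τ (W τ) ≠ 0 := by
    rw [hγ.bdryInv_driving hW τ, hγτ]
    exact_mod_cast hp0.ne'
  obtain ⟨η, hη, hacc⟩ := hγ.exists_accesses_le hW hW0 hp0 hτp halive htip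
  -- continuity of `W` at `τ`
  obtain ⟨δ, hδ, hδW⟩ := Metric.continuous_iff.1 hW τ (η / 4) (by positivity)
  set d₀ : ℝ≥0 := min ⟨δ / 2, by positivity⟩ ⟨η ^ 2 / 64, by positivity⟩ with hd₀
  have hd₀pos : 0 < d₀ := lt_min (by change (0 : ℝ) < δ / 2; positivity)
    (by change (0 : ℝ) < η ^ 2 / 64; positivity)
  refine ⟨η, hη, d₀, hd₀pos, fun d hd ↦ hγ.accesses_le_of_near hW hη hacc (fun u hu ↦ ?_) ?_⟩
  · have hu' : (u : ℝ) ≤ δ / 2 := by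
      have := hu.trans (hd.trans (min_le_left _ _))
      exact_mod_cast this
    have hdist : dist (τ + u) τ < δ := by
      rw [NNReal.dist_eq, NNReal.coe_add, add_sub_cancel_left, abs_of_nonneg u.coe_nonneg]
      linarith
    have := hδW (τ + u) hdist
    rw [Real.dist_eq] at this
    exact this.le
  · have hd' : (d : ℝ) ≤ η ^ 2 / 64 := by
      have := hd.trans (min_le_right _ _)
      exact_mod_cast this
    linarith

/-- **Bounded accesses with a gap, in the form of `accessGapTest`.** If all real zeros `v` of `f̄ₜ`
satisfy `v ≤ Wₜ - η/2` (`η > 0`), then for some naturals `N, j` they all satisfy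
`v - Wₜ ∈ [-N, -1/(j+1)]` (the zeros are bounded, `exists_norm_bdryInv_ofReal_sub_self_le`), i.e.
`accessGapTest W t (-N) (-1/(j+1))` holds (`accessGapTest_iff`).
[cite: RohdeSchramm2005, proof of Lemma 7.3 (p. 910)] -/
theorem IsGeneratedByCurve.exists_accessGapTest_of_accesses_le (hγ : IsGeneratedByCurve W γ)
    (hW : Continuous W) {t : ℝ≥0} {η : ℝ} (hη : 0 < η)
    (hacc : ∀ v : ℝ, bdryInv W t v = 0 → v ≤ W t - η / 2) :
    ∃ N j : ℕ, accessGapTest W t (-(N : ℝ)) (-(1 / ((j : ℝ) + 1))) := by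
  obtain ⟨C, hC⟩ := hγ.exists_norm_bdryInv_ofReal_sub_self_le hW t
  obtain ⟨N, hN⟩ := exists_nat_gt (C + |W t|)
  obtain ⟨j, hj⟩ := exists_nat_one_div_lt (half_pos hη)
  refine ⟨N, j, (hγ.accessGapTest_iff hW t _ _).2 fun v hv ↦ ⟨?_, ?_⟩⟩
  · have h1 := hC v
    rw [hv, zero_sub, norm_neg, Complex.norm_real, Real.norm_eq_abs] at h1
    have h2 := neg_abs_le v
    have h3 := le_abs_self (W t)
    linarith
  · have := hacc v hv
    have hj' : 1 / ((j : ℝ) + 1) < η / 2 := hj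
    linarith

/-! ### Step 3: sealing of the origin through the hull cocycle -/

/-- **Sealing of the origin through the cocycle.** Let the chain of `W` be generated by `γ`, let all
real zeros `v` of `f̄_q` satisfy `v - W_q ∈ [a, b]`, and suppose every real `w ∈ (a', b') ⊇ [a, b]`
is off the closure of the domain `H^{(q)}_s` of the chain of the increments `W(q + ·) - W(q)` at
time `s`. Then `K_{q+s} ⊇ {z ∈ ℍ : |z| < ε}` for some `ε > 0`. Otherwise points `zₙ → 0` of
`H_{q+s} = f_q(H^{(q)}_s + W_q)` (`domain_add_eq_image_incr`) are `zₙ = f_q(uₙ)`, `uₙ - W_q ∈ H^{(q)}_s`,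
with `(uₙ)` bounded (`|f_q(u) - u| ≤ C`); a cluster point `u*` has `f̄_q(u*) = 0`, so `u*` is real
(on `ℍ`, `f_q` takes values in `ℍ`) and `u* - W_q ∈ [a, b]` lies in the closure of `H^{(q)}_s`:
contradiction. [cite: RohdeSchramm2005, proof of Lemma 7.3 (p. 910)] -/
theorem IsGeneratedByCurve.exists_halfDisc_subset_hull_add (hγ : IsGeneratedByCurve W γ)
    (hW : Continuous W) {q s : ℝ≥0} {a b a' b' : ℝ}
    (hzeros : ∀ v : ℝ, bdryInv W q v = 0 → v - W q ∈ Icc a b) (ha : a' < a) (hb : b < b')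
    (hseal : ∀ w : ℝ, a' < w → w < b' →
      (w : ℂ) ∉ closure (domain (fun u ↦ W (q + u) - W q) s)) :
    ∃ ε : ℝ, 0 < ε ∧ {z ∈ upperHalfPlaneSet | ‖z‖ < ε} ⊆ hull W (q + s) := by
  by_contra hcon
  push Not at hcon
  -- points `z n → 0` of `H_{q+s}`
  have hz : ∀ n : ℕ, ∃ z : ℂ, z ∈ upperHalfPlaneSet ∧ ‖z‖ < 1 / ((n : ℝ) + 1) ∧ z ∉ hull W (q + s) := by
    intro n
    obtain ⟨z, hz, hzK⟩ := not_subset.1 (hcon (1 / ((n : ℝ) + 1)) (by positivity))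
    exact ⟨z, hz.1, hz.2, hzK⟩
  choose z hzH hzn hzK using hz
  have hzdom : ∀ n, z n ∈ domain W (q + s) := fun n ↦ ⟨hzH n, hzK n⟩
  -- `z n = f_q (u n)` with `u n - W q ∈ H^{(q)}_s`
  have hu : ∀ n, ∃ w : ℂ, w ∈ domain (fun u ↦ W (q + u) - W q) s ∧
      loewnerInv W q (w + (W q : ℂ)) = z n := by
    intro n
    have h := hzdom n
    rw [domain_add_eq_image_incr hW q s] at h
    obtain ⟨_, ⟨w, hw, rfl⟩, hwz⟩ := h
    exact ⟨w, hw, hwz⟩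
  choose w hwdom hwz using hu
  set u : ℕ → ℂ := fun n ↦ w n + (W q : ℂ) with hudef
  have huH : ∀ n, u n ∈ upperHalfPlaneSet := fun n ↦ by
    change 0 < (w n + (W q : ℂ)).im
    rw [add_im, ofReal_im, add_zero]
    exact domain_subset _ s (hwdom n)
  -- `(u n)` is bounded
  obtain ⟨C, hC⟩ := exists_norm_bdryInv_sub_self_le hW q
  have hubound : ∀ n, u n ∈ closedBall (0 : ℂ) (C + 1) := by
    intro n
    rw [mem_closedBall, dist_zero_right]
    have h1 := hC (u n) (huH n)
    rw [bdryInv_eq_of_mem hW q (huH n), hwz n] at h1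
    have h2 : ‖z n‖ < 1 := (hzn n).trans_le (by
      rw [div_le_one (by positivity)]; linarith [n.cast_nonneg (α := ℝ)])
    calc ‖u n‖ = ‖z n - (z n - u n)‖ := by ring_nf
      _ ≤ ‖z n‖ + ‖z n - u n‖ := norm_sub_le _ _
      _ ≤ C + 1 := by linarith
  obtain ⟨ustar, -, φ, hφ, hlim⟩ := tendsto_subseq_of_bounded (isBounded_closedBall (x := (0 : ℂ))
    (r := C + 1)) hubound
  -- `im u* ≥ 0` and `f̄_q(u*) = 0`
  have hcl : ustar ∈ {z : ℂ | 0 ≤ z.im} := by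
    rw [← closure_setOf_lt_im 0]
    exact mem_closure_of_tendsto hlim (Eventually.of_forall fun n ↦ huH (φ n))
  have hF0 : bdryInv W q ustar = 0 := by
    have hcont := (hγ.continuousOn_bdryInv hW q).continuousWithinAt hcl
    have h1 : Tendsto (fun n ↦ bdryInv W q (u (φ n))) atTop (𝓝 (bdryInv W q ustar)) :=
      hcont.tendsto.comp (tendsto_nhdsWithin_iff.2 ⟨hlim, Eventually.of_forall fun n ↦
        (show (0 : ℝ) < (u (φ n)).im from huH (φ n)).le⟩)
    have h2 : Tendsto (fun n ↦ bdryInv W q (u (φ n))) atTop (𝓝 0) := by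
      have h3 : ∀ n, bdryInv W q (u (φ n)) = z (φ n) := fun n ↦ by
        rw [bdryInv_eq_of_mem hW q (huH (φ n)), hwz (φ n)]
      simp_rw [h3]
      rw [tendsto_zero_iff_norm_tendsto_zero]
      refine squeeze_zero (fun n ↦ norm_nonneg _) (fun n ↦ (hzn (φ n)).le) ?_
      exact tendsto_one_div_add_atTop_nhds_zero_nat.comp
        (tendsto_natCast_atTop_atTop.comp hφ.tendsto_atTop) |>.congr fun n ↦ by simp
    exact tendsto_nhds_unique h1 h2
  -- `u*` is real
  have him : ustar.im = 0 := by
    refine le_antisymm (not_lt.1 fun hpos ↦ ?_) hcl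
    have hmem : bdryInv W q ustar ∈ domain W q := bdryInv_mem_domain hW q hpos
    have : (0 : ℝ) < (bdryInv W q ustar).im := domain_subset W q hmem
    rw [hF0, zero_im] at this
    exact lt_irrefl _ this
  have hureal : ustar = ((ustar.re : ℝ) : ℂ) := Complex.ext (by simp) (by simp [him])
  -- so `u*.re - W q ∈ [a, b] ⊂ (a', b')`, sealed off from `H^{(q)}_s`
  have hzero := hzeros ustar.re (by rw [← hureal]; exact hF0)
  rw [mem_Icc] at hzero
  refine hseal (ustar.re - W q) (by linarith) (by linarith) ?_
  have hwlim : Tendsto (fun n ↦ w (φ n)) atTop (𝓝 (((ustar.re - W q : ℝ) : ℂ))) := by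
    have h1 : Tendsto (fun n ↦ u (φ n) - (W q : ℂ)) atTop (𝓝 (ustar - (W q : ℂ))) :=
      hlim.sub tendsto_const_nhds
    have h2 : (fun n ↦ u (φ n) - (W q : ℂ)) = fun n ↦ w (φ n) := funext fun n ↦ by
      simp [hudef]
    rw [h2] at h1
    convert h1 using 2
    rw [hureal]
    push_cast
    simp
  exact mem_closure_of_tendsto hwlim (Eventually.of_forall fun n ↦ hwdom (φ n))

end Loewner

/-! ### The SLE statements -/

section SLE

variable {κ : ℝ≥0}

/-- **A.s. the access gap test holds at some rational time** (for SLE_κ generated by a curve with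
`T_1 < ∞` a.s., i.e. `κ > 4`): at rational times just after `T_1`, by
`exists_accessGap_after_swallowingTime_one` and `exists_accessGapTest_of_accesses_le`.
[cite: RohdeSchramm2005, proof of Lemma 7.3 (p. 910)] -/
theorem ae_exists_accessGapTest (h0 : HasSLETrace κ) (hκ4 : 4 < κ) :
    ∀ᵐ ω ∂Process.preWienerMeasure, ∃ q : ℚ, ∃ N j : ℕ,
      Loewner.accessGapTest (sleDriving κ ω) (ratTime q) (-(N : ℝ)) (-(1 / ((j : ℝ) + 1))) := by
  have hfin := sle_swallowingTime_lt_top_of_onePointMartingales sle_martingale_onePointPow_holds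
    sle_martingale_onePointSq_holds hκ4 one_pos
  filter_upwards [ae_isGeneratedByCurve_sleTrace h0, hfin] with ω hγ hT
  have hW := continuous_sleDriving κ ω
  have hW0 := sleDriving_zero κ ω
  obtain ⟨τ, hτ⟩ := WithTop.ne_top_iff_exists.1 hT.ne
  obtain ⟨η, hη, d₀, hd₀, hgap⟩ := hγ.exists_accessGap_after_swallowingTime_one hW hW0 hτ.symm
  -- a rational time in `(τ, τ + d₀)`
  obtain ⟨q, hq1, hq2⟩ := exists_rat_btwn (show (τ : ℝ) < τ + d₀ by
    have : (0 : ℝ) < d₀ := hd₀; linarith)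
  have hq0 : (0 : ℝ) ≤ q := τ.coe_nonneg.trans hq1.le
  have hqt : (ratTime q : ℝ) = q := Real.coe_toNNReal _ hq0
  have hτq : τ ≤ ratTime q := by
    rw [← NNReal.coe_le_coe, hqt]; exact hq1.le
  set d : ℝ≥0 := ratTime q - τ with hd
  have htd : τ + d = ratTime q := add_tsub_cancel_of_le hτq
  have hdle : d ≤ d₀ := by
    rw [← NNReal.coe_le_coe, hd, NNReal.coe_sub hτq, hqt]
    linarith
  have hacc := hgap d hdle
  rw [htd] at hacc
  obtain ⟨N, j, htest⟩ := hγ.exists_accessGapTest_of_accesses_le hW hη hacc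
  exact ⟨q, N, j, htest⟩

/-- **Some access gap event has positive probability** (countable union of full measure).
[cite: RohdeSchramm2005, proof of Lemma 7.3 (p. 910)] -/
theorem exists_measure_accessGapTest_ne_zero (h0 : HasSLETrace κ) (hκ4 : 4 < κ) :
    ∃ q : ℚ, ∃ N j : ℕ, Process.preWienerMeasure {ω |
      Loewner.accessGapTest (sleDriving κ ω) (ratTime q) (-(N : ℝ)) (-(1 / ((j : ℝ) + 1)))} ≠ 0 := by
  haveI := isProbabilityMeasure_preWienerMeasure'
  by_contra hall
  push Not at hall
  have hU : Process.preWienerMeasure (⋃ q : ℚ, ⋃ N : ℕ, ⋃ j : ℕ, {ω |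
      Loewner.accessGapTest (sleDriving κ ω) (ratTime q) (-(N : ℝ)) (-(1 / ((j : ℝ) + 1)))}) = 0 :=
    measure_iUnion_null fun q ↦ measure_iUnion_null fun N ↦ measure_iUnion_null fun j ↦ hall q N j
  have hae := ae_exists_accessGapTest h0 hκ4
  have huniv : Process.preWienerMeasure univ = 0 := by
    refine measure_mono_null_ae ?_ hU
    filter_upwards [hae] with ω hω _
    obtain ⟨q, N, j, hω⟩ := hω
    exact mem_iUnion.2 ⟨q, mem_iUnion.2 ⟨N, mem_iUnion.2 ⟨j, hω⟩⟩⟩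
  exact one_ne_zero (measure_univ.symm.trans huniv)

/-- **Transience of the SLE_κ trace for `4 < κ < 8`, from Rohde–Schramm's Cor. 3.5**: a.s.
`|γ(t)| → ∞` as `t → ∞`. This is the case `κ ∈ (4, 8)` of Rohde–Schramm (2005), Thm. 7.1, proved
along Lemma 7.3: a past event `A ∈ 𝓕_t` (access gap at a rational time `t`, positive probability)
and an independent future event (the increments swallow `[a - 1, b/2] ⊃ [a, b]` at once by time
`s₀`, positive probability by Lemma 6.6 reflected) force `K_{t+s₀} ⊇ {z ∈ ℍ : |z| < ε}`, and a
sealed half-disc with positive probability at a fixed time gives a.s. transience (zero-one law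
and scaling). [cite: RohdeSchramm2005, Thm 7.1 and Lemma 7.3] -/
theorem tendsto_norm_sleTrace_atTop_of_cor35_of_four_lt_of_lt_eight
    (h : RohdeSchramm2005_cor35 Process.preWienerMeasure) (hκ4 : 4 < κ) (hκ8 : κ < 8) :
    ∀ᵐ ω ∂Process.preWienerMeasure, Tendsto (fun t ↦ ‖sleTrace κ ω t‖) atTop atTop := by
  have h8 : κ ≠ 8 := ne_of_lt hκ8
  have hκ0 : κ ≠ 0 := by rintro rfl; exact absurd hκ4 (by norm_num)
  have h0 : HasSLETrace κ := hasSLETrace_of_ne_eight_of_cor35 h h8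
  -- Step 1: a past event of positive probability
  obtain ⟨q, N, j, hApos⟩ := exists_measure_accessGapTest_ne_zero h0 hκ4
  set t : ℝ≥0 := ratTime q with ht
  set a : ℝ := -(N : ℝ) with hadef
  set b : ℝ := -(1 / ((j : ℝ) + 1)) with hbdef
  have hb0 : b < 0 := by rw [hbdef]; exact neg_neg_of_pos (by positivity)
  have hA : MeasurableSet[brownianFiltration t] {ω | Loewner.accessGapTest (sleDriving κ ω) t a b} :=
    measurableSet_accessGapTest_sle κ t a b
  -- Step 2: the independent future event
  set a' : ℝ := a - 1 with ha'
  set b' : ℝ := b / 2 with hb'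
  have haa' : a' < a := by rw [ha']; linarith
  have hbb' : b < b' := by rw [hb']; linarith
  have hb'0 : b' < 0 := by rw [hb']; linarith
  have hab' : a' < b' := by
    have h1 : (1 : ℝ) / ((j : ℝ) + 1) ≤ 1 := by
      rw [div_le_one (by positivity)]; linarith [j.cast_nonneg (α := ℝ)]
    have h2 : (0 : ℝ) ≤ N := N.cast_nonneg
    rw [ha', hb', hadef, hbdef]
    linarith
  obtain ⟨s₀, hne⟩ := exists_measure_inter_shift_swallowAtOnceNeg_pos hκ4 hκ8 t hA hApos hab' hb'0
  -- Step 4: a sealed half-disc at time `t + s₀` with positive probability suffices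
  refine tendsto_norm_sleTrace_atTop_of_measure_halfDisc_ne_zero_at h0 (t + s₀) fun hzero ↦ hne ?_
  refine measure_mono_null_ae ?_ hzero
  -- Step 3: on both events (and the a.s. generation events) the half-disc is sealed
  filter_upwards [ae_isGeneratedByCurve_sleTrace h0,
    ae_exists_isGeneratedByCurve_shift_of_cor35 h hκ0 h8 t] with ω hγ hβ hω
  obtain ⟨hωA, hωF⟩ := hω
  obtain ⟨β, hβ⟩ := hβ
  have hW := continuous_sleDriving κ ω
  set V : ℝ≥0 → ℝ := fun u ↦ sleDriving κ ω (t + u) - sleDriving κ ω t with hV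
  have hVc : Continuous V :=
    ((continuous_sleDriving κ ω).comp (continuous_const.add continuous_id)).sub continuous_const
  have hV0 : V 0 = 0 := by simp [hV]
  -- the zeros of `f̄_t`
  have hzeros := (hγ.accessGapTest_iff hW t a b).1 hωA
  -- the future event: `T_{a'} = T_{b'} = T ≤ s₀` for the chain of `V`
  have hωF' : V ∈ swallowAtOnceNegEvent a' b' s₀ := hωF
  rw [mem_swallowAtOnceNegEvent_iff hVc hV0] at hωF'
  obtain ⟨hTeq, hTle⟩ := hωF'
  have hTfin : Loewner.swallowingTime V b' ≠ ⊤ := ne_top_of_le_ne_top WithTop.coe_ne_top hTle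
  obtain ⟨T, hT⟩ := WithTop.ne_top_iff_exists.1 hTfin
  have hTb : Loewner.swallowingTime V b' = T := hT.symm
  have hTa : Loewner.swallowingTime V a' = T := hTeq.trans hTb
  have hTs : T ≤ s₀ := by rw [← WithTop.coe_le_coe, hT]; exact hTle
  have hseal : ∀ w : ℝ, a' < w → w < b' → (w : ℂ) ∉ closure (Loewner.domain V s₀) :=
    fun w haw hwb ↦ hβ.notMem_closure_domain_of_swallowingTime_eq hVc hV0 haw hwb hb'0 hTa hTb hTs
  exact hγ.exists_halfDisc_subset_hull_add hW hzeros haa' hbb' hseal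

end SLE

end Literature.Probability.RandomPlanarGeometry
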